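import Mathlib
import HarnessLib
import HarnessLib.Audit
import Summits.AnomalousDissipation.Statement

/-!
Route: SabraStatics

CLOSED (retired) 2026-08-15T13:36:06Z by operator:999:1090267 — reason: not-a-thesis: assembly does not conclude the sub-problem Statement — note: D-0027 §2.1 audit (human 2026-08-15: routes that do not decide the summit are removed): the assembly concludes `StaticZerothLaw`, not the sub-problem statement; a NEW conforming route may be opened from the same idea (generated `closes : … → _root_.AnomalousDissipation`).. The file is kept as the record of this route; refuted decls are indexed as negative knowledge (`ledger negatives`).

Route SabraStatics — AnomalousDissipation/AnomalousDissipation. Realises idea card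
sabra-rung-monotonicity-test (graded new-combination twice). ANALOGUE RUNG (declared): X does NOT
imply `AnomalousDissipation`; frame #1 (X → summit) is not claimed and the Assembly closes X, not
the summit (precedent: Parity/CubicRoots). Bearing on the summit: calibration of
`…Theses.CoherentStates.SteadyZerothLaw` (0219) / `SteadyNeg` (0222) and of the dyadic-transplant
barrier card — is MONOTONE transfer essential to the only proved fixed-force cascade zeroth law
[CheskidovFriedlander2009]?

OBJECT. The real static Sabra/GOY chain (λ = 2, ε = 1/2; [Ditlevsen2010] eq. (3.52) with the
phase-locked reduction (4.11)/(4.13)–(4.14), u_n = i r_n, force f = iF on shell 1; common to GOY and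
Sabra statics, cf. [KadanoffLohseSchorghofer1997] §3 "the static solution u is real"): r : ℕ → ℝ, r
0 = 0 and for n ≥ 1
  STATIC(ν,F,r):  2^n ( r(n+1) r(n+2) − ¼ r(n−1) r(n+1) − ⅛ r(n−2) r(n−1) ) − ν 4^n r(n) + F·[n=1] =
0
(ℕ-truncated subtraction realises r_{−1} = r_0 = 0); REG(r): Summable (4^n r_n²) (finite dissipation
= the "smooth steady" class). Backscatter is present: two of the three couplings are negative and
amplitudes are signed.

THESIS X = StaticZerothLaw (target, rank 0; elaborates, Sketch.lean): "there are F > 0, E, ε₀ > 0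
and ν_j → 0⁺ with, for every j, a regular static solution r of STATIC(ν_j,F,·) with Σ r_n² ≤ E and
ν_j Σ 4^n r_n² ≥ ε₀" — verbatim the summit's shape (fixed steady force, bounded energy, dissipation
floor) one rung above the dyadic theorem, in the smallest cascade model with backscatter. Lean:
∃ F E ε₀ : ℝ, 0 < F ∧ 0 < ε₀ ∧ ∃ ν : ℕ → ℝ, (∀ j, 0 < ν j) ∧ Filter.Tendsto ν Filter.atTop (nhds 0)
∧ ∀ j, ∃ r : ℕ → ℝ, STATIC(ν j,F,r) ∧ Summable (fun n => (4:ℝ)^n * r n ^ 2) ∧ ∑' n, r n ^ 2 ≤ E ∧ ε₀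
≤ ν j * ∑' n, (4:ℝ)^n * r n ^ 2   (STATIC inlined; only Mathlib constants).

IT SUFFICES TO SHOW (two layers, crux statements first, glue later):
(C1, rank 2) KolmogorovCap — the ν-FREE cap problem: a real sequence ρ on ℤ solving ρ(m+1)ρ(m+2) −
¼ρ(m−1)ρ(m+1) − ⅛ρ(m−2)ρ(m−1) = 2^m ρ(m) for all m ∈ ℤ, with two-sided K41 bounds c ≤ 2^{m/3}|ρ_m| ≤
C for m ≤ 0 and Σ_{m≥0} 4^m ρ_m² < ∞ (decaying viscous tail). This is the static
K41-state-with-viscous-cap in Kolmogorov units (r_n = ν2^N ρ_{n−N}); it is NECESSARY for any loud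
bounded static branch (support LoudBranchNecessity, provable now) and, with transversality,
SUFFICIENT on the viscosity lattice ν_j = ν₀16^{−j} (gluing theorem = the planned split of C2).
(C2, rank 3) UniformLoudBranch — for ALL ν ∈ (0,ν₀): a regular static solution with Σ r_n² ≤ E and
r_1 ≥ c > 0 (no folds in ν). With the exact energy balance νΣ4^n r_n² = F·r_1 (support
StaticEnergyBalance) this gives X for every small ν, not only along a sequence.
(C3, rank 4) StaticCoercivity — census of QUIET states as a theorem: for small ν every
bounded-energy regular static solution is loud, r_1 ≥ c(F,E) > 0 (no static dodging despite
backscatter). Either outcome is informative: its refutation = a quiet bounded static branch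
shadowing a steep sparse inviscid dodger (the recorded SabraCoercivity witness u =
(0,u₂,u₃,0,u₅,0,…) is inviscid and finitely supported, hence not a viscous static solution).
ASSEMBLY (rank 1, proved in Sketch.lean, 25 lines): UniformLoudBranch → StaticEnergyBalance →
StaticZerothLaw.

Rationale: WHY THIS LINE. The only proved fixed-force vanishing-viscosity zeroth law [CheskidovFriedlander2009]
runs on sign-definite transfer (a_j > 0, monotone steady state, Heywood-type argument,
arXiv:0810.3718 §2 Thm 2.2). One rung up, the static Sabra/GOY chain has backscatter, a
sign-indefinite second invariant and an infinite family of work-free inviscid static DODGERS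
(r_{3m+1} = 0), yet its static problem is a rank-4 real recursion in the shell index whose inviscid
part is EXACTLY SOLVABLE: multiplying eq_n by r_n gives the linear recursion D_{n+1} = ½D_n +
½D_{n−1} + ν4^n r_n² − F r_1[n=1] for the triple products D_n = 2^{n−1}r_{n−1}r_n r_{n+1}; hence
forced inviscid statics have D_n = −(2/3)F r_1(1 + 2(−½)^n) (support InviscidForcedProfile), a K41
envelope with period-3 modulation g whose product g₂g₃ = −κF is a forcing-side invariant, and energy
flux Π_n = F r_1 − νΣ_{m≤n}4^m r_m² (so dissipation ≡ F·r_1: the zeroth law is a LARGE-SCALE floor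
r_1 ≥ c). The viscous problem is matched asymptotics in SCALE: forcing map (explicit) → neutral
period-3 modes through the inertial range → a ν-free cap recursion on ℤ (C1) whose decaying
solutions have codimension 2 and whose clean-K41 upstream condition has codimension 1, so admissible
caps form T-covariant curves (T: ρ ↦ ½ρ(·+1), flux ↦ flux/16); the Klein-four sign symmetry
{+++,+−−,−+−,−−+} makes the forcing-reachable signs automatic, leaving ONE scalar dilation condition
swept by ν ⇒ log-periodicity with period 16 = 3 shells × 2^{4/3} (support LogPeriodicBranch).
Imports: λ-lemma/connecting-orbit continuation and validated numerics (radii polynomials) from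
computer-assisted dynamics; [SchorghoferKadanoffLohse1995], [KadanoffLohseSchorghofer1997] supply
the non-rigorous version (4 ISR constants, 2-parameter VSR family, "two growing VSR modes set two
ISR parameters", ν → ν/λ⁴ & N → N+3 covariance with error O((1−ε)^{N_D})).
PLANNER NUMERICS (local, non-validated, 50-digit Newton on the N-shell Galerkin truncation, F = 1;
files num/ in the planner folder): a non-laminar static branch continues from ν = 10⁻² to 2·10⁻⁷ in
188 steps of 2^{−1/12} with 0 failures and ≤ 7 Newton steps each; it is log-periodic with period
exactly 16 (|r_1(ν) − r_1(16ν)| ≤ 1.5·10⁻³ at ν ~ 10⁻⁶, 2·10⁻⁵ at 10⁻⁹); over one period r_1 ∈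
[1.2336, 3.2907], Σr_n² ∈ [3.121, 13.235], dissipation = F r_1 to all digits; inertial triples show
g₂g₃ = −1.944 ± 0.005 independent of ν; the last 8 active shells coincide in Kolmogorov units at ν
and ν/16 (evidence for C1). Damped Newton from 7 near-sparse starts at ν = 10⁻⁵ never converged and
hovered on the dodger family with residual O(ν) (weak evidence for C3).
RANKED CRUXES. r2 KolmogorovCap (ν-free; validated-numerics entry point; ¬C1 ⇒ ¬X by
LoudBranchNecessity). r3 UniformLoudBranch (∀ν; folds excluded). r4 StaticCoercivity (census).
Target r0 StaticZerothLaw; r1 Assembly; supports r9: StaticEnergyBalance, InviscidForcedProfile,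
LoudBranchNecessity (X-type branch ⇒ C1; compactness + the D/Ψ bookkeeping, provable now),
LogPeriodicBranch (period-16 prediction, refutable).
KILL CRITERIA. ¬KolmogorovCap proved (no admissible cap: backscatter reflects the flux, a
"shell-space critical layer") ⇒ with LoudBranchNecessity, ¬X: close the route `refuted` and report
to CoherentStates (steady anomaly killed by backscatter one rung up). UniformLoudBranch refuted by a
fold but X alive ⇒ restate C2 on the lattice ν₀16^{−j}. StaticCoercivity refuted ⇒ drop it (not
load-bearing) and record the quiet branch as the informative theorem.
NOT DECOMPOSED YET. The gluing theorem (C1 + transversality of the admissible cap curve to the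
forcing dilation ⇒ lattice branch; then all ν) — to be filed as the split of C2 into
{CapTransversal, ForcingDilationCrossing, GluingLemma} once C1's enclosure fixes the transversality
notion; complex (phase-unlocked) Sabra statics; the time-dependent/invariant-measure Sabra zeroth
law (owned by card covariant-certificates-scale-induction-loglattice); non-laminar existence for all
ν < ν_c by the laminar index jump det = k₂k₃(ν²k₂k₃ − r_L²/32) < 0 ⇔ F² > 16384ν⁴ (degree theory;
calibration only).

Novelty: Searched (2026-08-15): lit search --source crossref ("viscous effects static solutions GOY shell
model", "stationary solutions Sabra shell model existence rigorous"), lit frontier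
AnomalousDissipation --since 2020 (30 newest descendants: none on shell models), lit read + page
reads of arXiv:0810.3718 (CheskidovFriedlander2009 §§1–2), arXiv:chao-dyn/9502014
(SchorghoferKadanoffLohse1995 pp.4–10), arXiv:chao-dyn/9603011 (KadanoffLohseSchorghofer1997 §2 and
App. A), arXiv:chao-dyn/9402005 (BiferaleLambertLimaPaladin1995), arXiv:chao-dyn/9804036
(L'vov–Podivilov–Procaccia 1999, Hamiltonian structure at ε = golden mean), book Ditlevsen2010
pp.80–88 (eqs 3.52, 4.4–4.15), the 114 idea cards of the summit (retired neighbours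
backscatter-ladder-sabra-loglattice-dia [refuted SabraCoercivity witness],
shell-selection-kolmogorov-vs-sparse-dodger and shell-ladder-scale-lambda-lemma-covariant-sos [both
superseded by this card], open covariant-certificates-scale-induction-loglattice [owns the ∀-form])
and `ledger negatives` (0). OpenAlex/arXiv APIs rate-limited (429), searchd/galaxyd intermittently
down; crossref + held texts used.
Nearest prior art: SchorghoferKadanoffLohse1995 (doi:10.1016/0167-2789(95)00186-8) and
KadanoffLohseSchorghofer1997 (doi:10.1016/s0167-2789(96)00174-1): NON-RIGOROUS matched asymptotics
and numerics of exactly this static object for GOY — 4 ISR constants (energy flux A, helicity flux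
B, two period-3 modulation parameters), a 2-parameter rapidly decaying VSR famil  [refs: 10.1016/0167-2789(95, 10.1016/s0167-2789(96, 0810.3718, chao-dyn/9502014, chao-dyn/9603011, chao-dyn/9402005, chao-dyn/9804036, doi:10.1016/0167-2789, doi:10.1016/s0167-2789, CheskidovFriedlander2009, SchorghoferKadanoffLohse1995, KadanoffLohseSchorghofer1997, BiferaleLambertLimaPaladin1995, Ditlevsen2010]

Barriers (technique_class: shell-model matched-asymptotics validated-numerics): technique_class: shell-model matched-asymptotics validated-numerics
All 18 catalogued AnomalousDissipation barriers are statements about NS/Euler/scalars on T³ or T²;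
none applies literally to a shell model and no technique_class token is shared. Morals addressed:
- Literature.Barriers.AnomalousDissipation.Marchioro1986_globalAttraction: gravest-mode forcing ⇒
laminar global attractor (2-D). Our forcing is on shell 1, but the shell analogue FAILS: the laminar
static state (F/(4ν),0,0,…) loses index at ν_c = (F²/16384)^{1/4} (Jacobian block on (r₂,r₃)), and a
non-laminar loud static branch is observed for all ν < 10⁻²; the chain's shell-1 equation is fed by
k₁r₂r₃, unlike Marchioro's first eigenspace where the trilinear term vanishes.
- Literature.Barriers.AnomalousDissipation.DrivasEyink2019_lemma1: uniform Onsager-supercritical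
regularity ⇒ no anomaly. Respected, not evaded: the loud branch sits exactly on the K41 envelope
2^{−n/3} up to the Kolmogorov shell and the dissipation is carried by the cap (shell analogue:
ConstantinLevantTiti2006-type σ > 1/3 weighted bounds uniform in ν would force νΣ4^n r_n² → 0; our
branch violates them by design).
- Literature.Barriers.AnomalousDissipation.Cheskidov2023_thm13_not_forceRobustNoAnomaly: blocks
force-robust NO-anomaly proofs; C1/C2/X are positive existence statements (outside the class); only
C3 (coercivity) is a no-quiet-state claim, and it uses the exact steady force through the pinned
pair r₂r₃ = −F/2 + 2νr₁, not a force-robus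

Novelty grade: new-combination — ROUTE REVIEW (refuter, 2026-08-15). 9/9 decls elaborate (rc0 on verbatim copy S4.lean); all items stamped with briefings. STATIC encoding verified: ℕ-truncated indices realise r_{−1} = r_0 = 0 (eq₁ = 2r₂r₃ − 4νr₁ + F = 0); laminar (0, F/(4ν), 0, …) satisfies STATIC ∧ REG in Lean (Scratch4.lean rc0)  (refuter refuter-rreview-route-Langlands-Rational-fcbb152a-0, 2026-08-15T11:46:07Z; prior: doi:10.1016/0167-2789(95)00186-8 (SchorghoferKadanoffLohse1995), doi:10.1016/s0167-2789(96)00174-1 (KadanoffLohseSchorghofer1997), arXiv:0810.3718 (CheskidovFriedlander2009), arXiv:chao-dyn/9402005, arXiv:chao-dyn/9804036, Ditlevsen2010 eqs 3.52, 4.11-4.15)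

History (route lifecycle, newest last):
- 2026-08-15T13:36:06Z · CLOSED retired — not-a-thesis: assembly does not conclude the sub-problem Statement (operator:999:1090267)

sub-problem: AnomalousDissipation · status: closed(retired) · opened planner-plancard-AnomalousDissipation-Anomalo-3afa48ee-0 2026-08-15T11:09:02Z · rev 1 · ledger route-AnomalousDissipation-SabraStatics
GENERATED by the gate from the ledger (D-0016/17). Provers cite these decls: `theorem foo : Summit.AnomalousDissipation.AnomalousDissipation.Theses.SabraStatics.<Decl> := …` in Summits/AnomalousDissipation/AnomalousDissipation/Theorems/<Name>.lean.
-/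

namespace Summit.AnomalousDissipation.AnomalousDissipation.Theses.SabraStatics

open scoped BigOperators Topology Manifold Classical MeasureTheory ProbabilityTheory Matrix InnerProductSpace ComplexConjugate ContinuousMap
open Filter Set Function TopologicalSpace MeasureTheory

attribute [summit_statement] _root_.AnomalousDissipation

open Literature.Turb

/-- item stmt-AnomalousDissipation-2841 · target · rank 0 · closed · moot by None · by planner
why it might fail: False if backscatter kills STEADY anomaly: every bounded static branch could turn quiet (r_1 -> 0) or cease to exist as nu -> 0; notKolmogorovCap would certify it via LoudBranchNecessity. Numerics (SKL95, KLS97 App. A, planner continuation to nu=2e-7) say true.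
sources: CheskidovFriedlander2009, SchorghoferKadanoffLohse1995, KadanoffLohseSchorghofer1997, Ditlevsen2010, LvovEtAl1998
[target] Static Sabra/GOY zeroth law (thesis X): fixed force F on shell 1, viscosities nu_j -> 0,
REGULAR static solutions of the real chain (STATIC inlined: r 0 = 0 and 2^n(r(n+1)r(n+2) - 1/4
r(n-1)r(n+1) - 1/8 r(n-2)r(n-1)) - nu 4^n r n + F[n=1] = 0 for n >= 1; Ditlevsen2010 (3.52)/(4.11)
at lambda=2, eps=1/2, u_n = i r_n) with bounded energy sum r_n^2 <= E and dissipation nu_j sum 4^n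
r_n^2 >= eps0 > 0. One rung above CheskidovFriedlander2009 (monotone dyadic). Analogue rung: does
not imply the summit. -/
@[route_item "route-AnomalousDissipation-SabraStatics"]
def StaticZerothLaw : Prop :=
  ∃ F E ε₀ : ℝ, 0 < F ∧ 0 < ε₀ ∧ ∃ ν : ℕ → ℝ, (∀ j, 0 < ν j) ∧ Filter.Tendsto ν Filter.atTop (nhds 0) ∧ ∀ j, ∃ r : ℕ → ℝ, (r 0 = 0 ∧ ∀ n : ℕ, 1 ≤ n → (2:ℝ) ^ n * (r (n+1) * r (n+2) - 1/4 * (r (n-1) * r (n+1)) - 1/8 * (r (n-2) * r (n-1))) - ν j * (4:ℝ) ^ n * r n + (if n = 1 then F else 0) = 0) ∧ Summable (fun n : ℕ => (4:ℝ) ^ n * r n ^ 2) ∧ ∑' n : ℕ, r n ^ 2 ≤ E ∧ ε₀ ≤ ν j * ∑' n : ℕ, (4:ℝ) ^ n * r n ^ 2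

/-- item stmt-AnomalousDissipation-2843 · crux · rank 2 · closed · moot by None · by planner
why it might fail: Every decaying solution of the cap recursion might carry a nonzero upstream helicity-flux mode B(-1/2)^m (codim-1 clean-K41 condition never met on the 2-dim decaying family): backscatter reflects the flux, no admissible cap, hence notX. Planner numerics (caps agree at nu and nu/16) say it exists.
sources: SchorghoferKadanoffLohse1995, KadanoffLohseSchorghofer1997, BiferaleLambertLimaPaladin1995, Ditlevsen2010, CheskidovFriedlander2009
[crux, rank 2] The nu-FREE Kolmogorov cap: a real sequence rho on Z solving the unforced static
recursion with unit viscosity, rho(m+1)rho(m+2) - 1/4 rho(m-1)rho(m+1) - 1/8 rho(m-2)rho(m-1) = 2^m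
rho(m) (all m in Z), with two-sided K41 bounds c <= 2^{m/3}|rho_m| <= C upstream (m <= 0; equivalent
to: no growing helicity-flux mode, nonzero energy flux, no zeros) and a summable viscous tail
sum_{m>=0} 4^m rho_m^2 (downstream the decay is doubly exponential, ln|rho| ~ -a*golden^m, SKL95).
Obtained from any loud static solution by r_n = nu 2^N rho_{n-N} at the Kolmogorov shell N ~
(3/4)log2(F r_1/nu); NECESSARY for X (support LoudBranchNecessity) and the entry point for validated
numerics (interval shooting / radii polynomials on a finite window + contraction tails both ways).
Count: decaying solutions = codim 2 in the 4-dim recursion phase space, clean upstream = codim 1 =>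
admissible caps form curves, covariant under T rho = (1/2) rho(.+1) (flux -> flux/16) and under the
Klein-four period-3 sign group {+++,+--,-+-,--+}. -/
@[route_item "route-AnomalousDissipation-SabraStatics"]
def KolmogorovCap : Prop :=
  ∃ ρ : ℤ → ℝ, (∀ m : ℤ, ρ (m+1) * ρ (m+2) - 1/4 * (ρ (m-1) * ρ (m+1)) - 1/8 * (ρ (m-2) * ρ (m-1)) = (2:ℝ) ^ m * ρ m) ∧ (∃ c C : ℝ, 0 < c ∧ ∀ m : ℤ, m ≤ 0 → c ≤ (2:ℝ) ^ ((m:ℝ) / 3) * |ρ m| ∧ (2:ℝ) ^ ((m:ℝ) / 3) * |ρ m| ≤ C) ∧ Summable (fun m : ℕ => (4:ℝ) ^ m * ρ m ^ 2)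

/-- item stmt-AnomalousDissipation-2844 · crux · rank 3 · closed · moot by None · by planner
why it might fail: Folds (saddle-nodes in nu) would break the all-nu form while X survives on log-periodic windows: SKL95 found saddle-nodes for shell-4 forcing (their Fig. 12); KLS97 App. A saw none for shell-1 forcing; planner continuation 1e-2 -> 2e-7 (188 steps) met none.
sources: SchorghoferKadanoffLohse1995, KadanoffLohseSchorghofer1997, KadanoffEtAl1995
[crux, rank 3] For ALL nu in (0, nu0): a regular static solution with energy <= E and first-shell
amplitude r_1 >= c > 0 (loud: dissipation = F r_1 by StaticEnergyBalance). Stronger than X (no folds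
/ no log-periodic gaps). Intended proof = the gluing theorem: KolmogorovCap + transversality of the
admissible cap curve to the forcing dilation => branch on the lattice nu0 16^{-j} (exponentially
small coupling O(2^{-N_D/2}) between the explicit forced-inviscid profile and the cap, KLS97 sec.
2), then all nu iff the cap family covers a full flux period. Planned split once C1 closes:
{CapTransversal, ForcingDilationCrossing, GluingLemma}. -/
@[route_item "route-AnomalousDissipation-SabraStatics"]
def UniformLoudBranch : Prop :=
  ∃ F ν₀ c E : ℝ, 0 < F ∧ 0 < ν₀ ∧ 0 < c ∧ ∀ ν : ℝ, 0 < ν → ν < ν₀ → ∃ r : ℕ → ℝ, (r 0 = 0 ∧ ∀ n : ℕ, 1 ≤ n → (2:ℝ) ^ n * (r (n+1) * r (n+2) - 1/4 * (r (n-1) * r (n+1)) - 1/8 * (r (n-2) * r (n-1))) - ν * (4:ℝ) ^ n * r n + (if n = 1 then F else 0) = 0) ∧ Summable (fun n : ℕ => (4:ℝ) ^ n * r n ^ 2) ∧ ∑' n : ℕ, r n ^ 2 ≤ E ∧ c ≤ r 1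

/-- item stmt-AnomalousDissipation-2845 · crux · rank 4 · closed · moot by None · by planner
why it might fail: A discrete family of quiet branches r_1 ~ nu^a shadowing steep sparse inviscid dodgers (r_{3m+1}=0; the refuted card-level SabraCoercivity witness (0,u2,u3,0,u5,0,...) shows bounded inviscid dodgers exist) may exist: the shooting count (2 parameters, 2 cap conditions) is balanced.
sources: Ditlevsen2010, LvovEtAl1998, ConstantinLevantTiti2006, CheskidovFriedlander2009
[crux, rank 4] Quiet-state census as a theorem (static coercivity): for F > 0 and any energy level E
there are c, nu0 > 0 such that every REGULAR static solution with nu < nu0 and energy <= E has r_1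
>= c (equivalently dissipation >= F c): no static dodging despite backscatter. Not needed for the
Assembly; either outcome is informative (its negation = a quiet bounded static branch = steady
anomaly killed by backscatter in the toy, calibrating CoherentStates.SteadyNeg). Shape of a
counterexample if any: sparse shells n = 1 mod 3 of relative size ~ nu k_n, loud shells on a STEEP
(fluxless, k^{-2/3}) inviscid dodger, cap at k ~ nu^{-3/5}, dissipation ~ nu^{3/5}. Evidence for:
perturbing the finite dodger (0,u2,u3,0,u5,0,...) at nu > 0 forces O(1) amplitudes downstream;
damped Newton from near-sparse starts finds no root (residual stuck at O(nu)). -/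
@[route_item "route-AnomalousDissipation-SabraStatics"]
def StaticCoercivity : Prop :=
  ∀ F E : ℝ, 0 < F → ∃ c ν₀ : ℝ, 0 < c ∧ 0 < ν₀ ∧ ∀ (ν : ℝ) (r : ℕ → ℝ), 0 < ν → ν < ν₀ → (r 0 = 0 ∧ ∀ n : ℕ, 1 ≤ n → (2:ℝ) ^ n * (r (n+1) * r (n+2) - 1/4 * (r (n-1) * r (n+1)) - 1/8 * (r (n-2) * r (n-1))) - ν * (4:ℝ) ^ n * r n + (if n = 1 then F else 0) = 0) → Summable (fun n : ℕ => (4:ℝ) ^ n * r n ^ 2) → ∑' n : ℕ, r n ^ 2 ≤ E → c ≤ r 1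

/-- item stmt-AnomalousDissipation-2846 · support · rank 9 · closed · moot by None · by planner
[support, provable now] Energy balance of regular statics: nu sum 4^n r_n^2 = F r_1. Multiply eq_n
by r_n and sum n <= N: the cascade terms telescope to -(T_N + T_{N-1}/2), T_n = 2^n r_n r_{n+1}
r_{n+2} (energy flux Pi_N = F r_1 - nu sum_{n<=N} 4^n r_n^2 = -(T_N + T_{N-1}/2)); Summable 4^n
r_n^2 gives |r_n| <= C 2^{-n}, so T_N -> 0. ~150 lines (Finset sums, tendsto of partial sums). The
analogue of CF2009's mu sum lambda^{beta j} A_j^2 = A_0. -/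
@[route_item "route-AnomalousDissipation-SabraStatics"]
def StaticEnergyBalance : Prop :=
  ∀ (ν F : ℝ) (r : ℕ → ℝ), 0 < ν → (r 0 = 0 ∧ ∀ n : ℕ, 1 ≤ n → (2:ℝ) ^ n * (r (n+1) * r (n+2) - 1/4 * (r (n-1) * r (n+1)) - 1/8 * (r (n-2) * r (n-1))) - ν * (4:ℝ) ^ n * r n + (if n = 1 then F else 0) = 0) → Summable (fun n : ℕ => (4:ℝ) ^ n * r n ^ 2) → ν * ∑' n : ℕ, (4:ℝ) ^ n * r n ^ 2 = F * r 1

/-- item stmt-AnomalousDissipation-2847 · support · rank 9 · closed · moot by None · by planner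
[support, provable now] Exact solvability of the forced INVISCID statics: for the triple products
D_n = 2^{n-1} r_{n-1} r_n r_{n+1}, eq_n * r_n gives the LINEAR recursion D_{n+1} = D_n/2 + D_{n-1}/2
(n >= 2), D_2 = -F r_1, D_3 = D_2/2; hence D_n = -(2/3) F r_1 (1 + 2(-1/2)^n) for n >= 2 (verified
to 50 digits). Consequences provers may add with --supports: all r_n != 0 when r_1 r_2 != 0;
explicit profile r_3 = -F/(2r_2), r_4 = r_1/4, r_5 = 3r_2/4, r_6 = -(5/24)F/r_2, ...; K41 units s_n
= 2^{n/3} r_n converge geometrically (ratio -1/2) to a period-3 pattern g = (alpha r_1, beta r_2,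
-gamma F/r_2) with invariant g_2 g_3 = -kappa F (numerically kappa = 1.944). -/
@[route_item "route-AnomalousDissipation-SabraStatics"]
def InviscidForcedProfile : Prop :=
  ∀ (F : ℝ) (r : ℕ → ℝ), (r 0 = 0 ∧ ∀ n : ℕ, 1 ≤ n → (2:ℝ) ^ n * (r (n+1) * r (n+2) - 1/4 * (r (n-1) * r (n+1)) - 1/8 * (r (n-2) * r (n-1))) + (if n = 1 then F else 0) = 0) → ∀ n : ℕ, 2 ≤ n → (2:ℝ) ^ (n-1) * (r (n-1) * r n * r (n+1)) = -(2/3) * F * r 1 * (1 + 2 * (-1/2:ℝ) ^ n)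

/-- item stmt-AnomalousDissipation-2848 · support · rank 9 · closed · moot by None · by planner
[support, provable now with work] NECESSITY of the cap: a loud bounded regular static branch along
some nu_j -> 0 (energy <= E, r_1 >= c) yields KolmogorovCap. Plan: exact bookkeeping D_{n+1} = D_n/2
+ D_{n-1}/2 + nu 4^n r_n^2 - F r_1[n=1], energy flux Pi_n = F r_1 - dissipation_{<=n} in [0, F r_1],
second mode Psi_n = D_{n+1} - D_n = -Psi_{n-1}/2 + nu 4^n r_n^2; define the cap shell N_j by
dissipation_{<=N_j} ~ theta F r_1; below it two-sided bounds on D_n and bounded modulation drift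
(sum of Psi kicks <= O(dissipation so far)) give c' <= 2^{n/3}|r_n| <= C' with constants from
(F,c,E) only (|r_2|,|r_3| >= (F - 4 nu sqrt E)/(2 sqrt E)); nu_j 2^{4N_j/3} is two-sided bounded;
rescale rho^{(j)}_m = r_{N_j+m}/(nu_j 2^{N_j}), extract a pointwise limit on Z (diagonal), pass the
recursion, the upstream bounds and (Fatou) the tail bound to the limit. Makes notKolmogorovCap =>
notX rigorous (kill criterion). -/
@[route_item "route-AnomalousDissipation-SabraStatics"]
def LoudBranchNecessity : Prop :=
  (∃ F c E : ℝ, 0 < F ∧ 0 < c ∧ ∃ ν : ℕ → ℝ, (∀ j, 0 < ν j) ∧ Filter.Tendsto ν Filter.atTop (nhds 0) ∧ ∀ j, ∃ r : ℕ → ℝ, (r 0 = 0 ∧ ∀ n : ℕ, 1 ≤ n → (2:ℝ) ^ n * (r (n+1) * r (n+2) - 1/4 * (r (n-1) * r (n+1)) - 1/8 * (r (n-2) * r (n-1))) - ν j * (4:ℝ) ^ n * r n + (if n = 1 then F else 0) = 0) ∧ Summable (fun n : ℕ => (4:ℝ) ^ n * r n ^ 2) ∧ ∑' n : ℕ, r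 n ^ 2 ≤ E ∧ c ≤ r 1) → KolmogorovCap

/-- item stmt-AnomalousDissipation-2849 · support · rank 9 · closed · moot by None · by planner
[support, mechanism-specific prediction, refutable] A choice of loud bounded regular statics r^nu
for all nu in (0, nu0) with r^{nu/16}_1 - r^nu_1 -> 0 as nu -> 0+: log-periodicity with period
exactly 16 = lambda^4 (3 shells x 2^{4/3}), the rigorous form of KLS97's covariance nu ->
nu/lambda^4, N -> N+3 with error O((1-eps)^{N_D}). Planner numerics: |r_1(nu) - r_1(16 nu)| <=
1.5e-3 at nu ~ 1e-6, ~2e-5 at 1e-9. Implies UniformLoudBranch. -/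
@[route_item "route-AnomalousDissipation-SabraStatics"]
def LogPeriodicBranch : Prop :=
  ∃ F ν₀ c E : ℝ, 0 < F ∧ 0 < ν₀ ∧ 0 < c ∧ ∃ r : ℝ → ℕ → ℝ, (∀ ν : ℝ, 0 < ν → ν < ν₀ → ((r ν 0 = 0 ∧ ∀ n : ℕ, 1 ≤ n → (2:ℝ) ^ n * (r ν (n+1) * r ν (n+2) - 1/4 * (r ν (n-1) * r ν (n+1)) - 1/8 * (r ν (n-2) * r ν (n-1))) - ν * (4:ℝ) ^ n * r ν n + (if n = 1 then F else 0) = 0) ∧ Summable (fun n : ℕ => (4:ℝ) ^ n * r ν n ^ 2) ∧ ∑' n : ℕ, r ν n ^ 2 ≤ E ∧ c ≤ r ν 1)) ∧ Filter.Tendsto (fun ν : ℝ => r (ν / 16) 1 - r ν 1) (nhdsWithin 0 (Set.Ioi 0)) (nhds 0)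

/-- item stmt-AnomalousDissipation-2842 · assembly · rank 1 · closed · moot by None · by planner
[assembly] UniformLoudBranch -> StaticEnergyBalance -> StaticZerothLaw: take nu_j = nu0/2^(j+1); the
balance nu sum 4^n r_n^2 = F r_1 turns r_1 >= c into the dissipation floor eps0 = F c. Proved in the
planner's Sketch.lean (25 lines); closes X, not the summit (analogue rung, declared). -/
@[route_item "route-AnomalousDissipation-SabraStatics"]
def Assembly : Prop :=
  UniformLoudBranch → StaticEnergyBalance → StaticZerothLaw

end Summit.AnomalousDissipation.AnomalousDissipation.Theses.SabraStatics
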